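import Summits.Ventures.YMGap.RobustBall.SummableSpecification
import Summits.Ventures.YMGap.RobustBall.MassGapOnBall
import HarnessLib

/-!
# Venture YMGap, track ROBUST-BALL (tier 2) — THE STATEMENT: the ball of SUMMABLE link potentials in the
# `e^{t‖·‖_∞}`-weighted norm, its target type `MassGapOnBallZdS`, and the inclusion of the tier-1 ball

HONEST FRAMING. WHAT THIS IS: a venture file (cell `pub-ymgap`, track Y2 ROBUST-BALL, seat rb-p1) fixing the
TYPE of the tier-2 theorem (proved in `SummableUniqueness.lean` / `SummableMassGap.lean`):
* `PerturbedMassGapAtS d N β W` — the cell's `MassGapAt d N β` verbatim for the summable member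
  `perturbedYMS (fundamentalRep (Fin N)) (N β) W` (exactly one DLR state; exponential clustering of Lipschitz
  cylinder observables in the Shen–Zhu–Zhu form); for a potential supported by finite families it IS the
  tier-1 `PerturbedMassGapAt d N β W supp` (`perturbedMassGapAtS_iff_of_supportedBy`, through
  `perturbedYMS_eq_perturbedYM`);
* `MemBallZdS a Λ t W` — MEMBERSHIP in the tier-2 ball: continuous own-link terms, a summable majorant,
  oscillation load `∑'_{X ∋ e} osc X e ≤ a`, and DIAGONAL-FREE WEIGHTED cross-Lipschitz load
  `∑'_{y ≠ e} ℓ(e, y) e^{t‖e - y‖_∞} ≤ Λ` with `ℓ(e, y) ≥ ∑'_{X ∋ e, y} lip X y` — two numbers and a weight,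
  no range, no support list (the directive's `e^{t·diam}`-weighted Banach ball);
* `MassGapOnBallZdS d N β a Λ t` — THE TIER-2 TARGET TYPE: every member has `PerturbedMassGapAtS d N β W`;
* THE INCLUSION `MemBallZd.memBallZdS`: a tier-1 member of radii `(ε₀, ε₁)` and range `R` is a tier-2 member
  of loads `(ε₀, e^{tR} ε₁)` at every weight `t ≥ 0`; hence `MassGapOnBallZdS d N β a Λ t` IMPLIES
  `MassGapOnBallZd d N β ε₀ ε₁ R` whenever `ε₀ ≤ a` and `e^{tR} ε₁ ≤ Λ` (`MassGapOnBallZdS.massGapOnBallZd`) —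
  the tier-2 theorem contains the tier-1 theorem.
Nothing is asserted by the definitions. WHAT IT IS NOT: no door, no number; nothing about the continuum.
-/

noncomputable section

open MeasureTheory Filter Function ProbabilityTheory Real Topology
open scoped NNReal
open Literature.Probability.LatticeModels
open Literature.Probability.LatticeModels.DobrushinMetric
open Literature.MathematicalPhysics.QuantumLattice
open Literature.MathematicalPhysics.QuantumFieldTheory hiding ZdEdge

namespace Summit.Ventures.YMGap.RobustBall

variable {d N : ℕ}

/-! ### Potentials supported by finite families: the tier-2 objects are the tier-1 objects -/

section Supported

variable {G : Type*} [Group G] (ρ : G →* Matrix (Fin N) (Fin N) ℂ)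

/-- For a potential supported by the finite families `supp` (tree `Potential.IsSupportedBy`) the summable
energy is the tier-1 energy: the series over the sets meeting `Λ` is the finite sum over `supp Λ`
(Georgii 2011, (2.11) and Ex. 2.12). -/
theorem perturbedEnergyS_eq_perturbedEnergy (β : ℝ) {W : Potential (ZdEdge d) G}
    {supp : Finset (ZdEdge d) → Finset (Finset (ZdEdge d))} (hsupp : W.IsSupportedBy supp)
    (Λ : Finset (ZdEdge d)) : perturbedEnergyS ρ β W Λ = perturbedEnergy ρ β W supp Λ := by
  classical
  funext U
  unfold perturbedEnergyS perturbedEnergy hamiltonianIn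
  congr 1
  rw [Finset.sum_filter, tsum_eq_sum (s := supp Λ) (fun X hX => ?_)]
  split_ifs with hXΛ
  · by_contra hne
    exact hX (hsupp Λ X hXΛ fun h0 => hne (by rw [h0]; rfl))
  · rfl

variable [TopologicalSpace G] [IsTopologicalGroup G] [CompactSpace G] [MeasurableSpace G] [BorelSpace G]

/-- For a supported potential the tier-2 specification is the tier-1 specification. -/
theorem perturbedYMS_eq_perturbedYM (β : ℝ) {W : Potential (ZdEdge d) G}
    {supp : Finset (ZdEdge d) → Finset (Finset (ZdEdge d))} (hsupp : W.IsSupportedBy supp) :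
    perturbedYMS (d := d) ρ β W = perturbedYM ρ β W supp := by
  funext Λ η
  simp only [perturbedYMS, perturbedYM, perturbedEnergyS_eq_perturbedEnergy ρ β hsupp Λ]

end Supported

/-! ### The tier-2 mass-gap predicate and the weighted ball -/

section Ball

variable (d N) in
/-- **Mass gap of a summable member** `N β S_W + W` on `ℤ^d` ('t Hooft coupling `β`): the cell's
`MassGapAt d N β` verbatim for `perturbedYMS (fundamentalRep (Fin N)) (N β) W` — (i) exactly one DLR state,
(ii) for every DLR state a rate `c > 0` and, for every support size `n`, a constant `c₁` with
`|cov_μ(F₁, F₂)| ≤ c₁ e^{-c d(Λ₁, Λ₂)} (K₁ K₂ + ‖F₁‖₂ ‖F₂‖₂)` for Lipschitz cylinder observables. -/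
def PerturbedMassGapAtS (β : ℝ) (W : Potential (ZdEdge d) (Matrix.specialUnitaryGroup (Fin N) ℂ)) : Prop :=
  HasUniqueGibbsMeasure (perturbedYMS (d := d) (fundamentalRep (Fin N)) (N * β) W) ∧
    ∀ μ ∈ perturbedGibbsMeasuresS (d := d) (fundamentalRep (Fin N)) (N * β) W,
      ∃ c : ℝ, 0 < c ∧ ∀ n : ℕ, ∃ c₁ : ℝ,
        ∀ (F₁ F₂ : LGConfig d (Matrix.specialUnitaryGroup (Fin N) ℂ) → ℝ)
          (Λ₁ Λ₂ : Finset (ZdEdge d)) (K₁ K₂ : ℝ≥0),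
          Λ₁.card ≤ n → Λ₂.card ≤ n → Disjoint Λ₁ Λ₂ →
          IsLipschitzCylinder (fundamentalRep (Fin N)) F₁ Λ₁ K₁ →
          IsLipschitzCylinder (fundamentalRep (Fin N)) F₂ Λ₂ K₂ →
            |cov[F₁, F₂; μ]| ≤ c₁ * Real.exp (-c * setDistEdges Λ₁ Λ₂) *
              ((K₁ : ℝ) * K₂ + Real.sqrt (∫ U, F₁ U ^ 2 ∂μ) * Real.sqrt (∫ U, F₂ U ^ 2 ∂μ))

/-- For a potential supported by finite families the tier-2 mass gap IS the tier-1 mass gap. -/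
theorem perturbedMassGapAtS_iff_of_supportedBy (β : ℝ)
    {W : Potential (ZdEdge d) (Matrix.specialUnitaryGroup (Fin N) ℂ)}
    {supp : Finset (ZdEdge d) → Finset (Finset (ZdEdge d))} (hsupp : W.IsSupportedBy supp) :
    PerturbedMassGapAtS d N β W ↔ PerturbedMassGapAt d N β W supp := by
  unfold PerturbedMassGapAtS PerturbedMassGapAt perturbedGibbsMeasuresS perturbedGibbsMeasures
  rw [perturbedYMS_eq_perturbedYM _ _ hsupp]

/-- **Membership in the tier-2 (weighted, summable) ball** of loads `(a, Λ)` at weight `t`: continuous terms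
depending on their own links, a summable link majorant, oscillation witnesses with
`∑'_{X ∋ e} osc X e ≤ a`, Lipschitz (Frobenius) witnesses with summable moduli through every pair of links
and a cross coefficient `ℓ(e, y) ≥ ∑'_{X ∋ e, y} lip X y` (`y ≠ e`) of diagonal-free weighted rows
`∑'_{y ≠ e} ℓ(e, y) e^{t‖e - y‖_∞} ≤ Λ`. -/
structure MemBallZdS (a Λ t : ℝ) (W : Potential (ZdEdge d) (Matrix.specialUnitaryGroup (Fin N) ℂ)) : Prop where
  /-- every term is continuous -/
  continuous : ∀ X, Continuous (W X)
  /-- every term depends only on the links of its set -/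
  dependsOn : ∀ X, DependsOn (W X) (↑X : Set (ZdEdge d))
  /-- a summable link majorant -/
  summable : ∃ B, IsLinkSummable W B
  /-- the loads -/
  loads : ∃ (osc lip : Finset (ZdEdge d) → ZdEdge d → ℝ) (ℓ : ZdEdge d → ZdEdge d → ℝ),
    (∀ X, Dobrushin.IsOscBound (W X) (osc X)) ∧ (∀ X, IsLipBound suFrobDist (W X) (lip X)) ∧
      (∀ e, Summable fun X : Finset (ZdEdge d) => (if e ∈ X then osc X e else 0)) ∧
      (∀ e, ∑' X : Finset (ZdEdge d), (if e ∈ X then osc X e else 0) ≤ a) ∧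
      (∀ e y, Summable fun X : Finset (ZdEdge d) => (if e ∈ X ∧ y ∈ X then lip X y else 0)) ∧
      (∀ e y, y ≠ e → ∑' X : Finset (ZdEdge d), (if e ∈ X ∧ y ∈ X then lip X y else 0) ≤ ℓ e y) ∧
      (∀ e, Summable fun y => (if y = e then 0 else ℓ e y) * exp (t * ‖e.1 - y.1‖)) ∧
      (∀ e, ∑' y, (if y = e then 0 else ℓ e y) * exp (t * ‖e.1 - y.1‖) ≤ Λ)

/-- The ball is monotone in its loads. -/
theorem MemBallZdS.mono {a Λ t a' Λ' : ℝ} {W : Potential (ZdEdge d) (Matrix.specialUnitaryGroup (Fin N) ℂ)}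
    (h : MemBallZdS a Λ t W) (ha : a ≤ a') (hΛ : Λ ≤ Λ') : MemBallZdS a' Λ' t W := by
  obtain ⟨osc, lip, ℓ, h1, h2, h3, h4, h5, h6, h7, h8⟩ := h.loads
  exact ⟨h.continuous, h.dependsOn, h.summable, osc, lip, ℓ, h1, h2, h3, fun e => (h4 e).trans ha, h5, h6, h7,
    fun e => (h8 e).trans hΛ⟩

/-- The zero potential is a member of every tier-2 ball with nonnegative loads (the centre: Wilson). -/
theorem memBallZdS_zero {a Λ t : ℝ} (ha : 0 ≤ a) (hΛ : 0 ≤ Λ) : MemBallZdS (d := d) (N := N) a Λ t 0 where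
  continuous _ := continuous_const
  dependsOn _ _ _ _ := rfl
  summable := ⟨fun _ => 0, fun _ _ => by simp, fun _ => by simp⟩
  loads := ⟨fun _ _ => 0, fun _ _ => 0, fun _ _ => 0, fun _ => ⟨fun _ => le_rfl, fun _ _ _ _ => by simp⟩,
    fun _ => ⟨fun _ => le_rfl, fun _ _ _ _ => by simp⟩, fun _ => by simp,
    fun _ => by simpa using ha, fun _ _ => by simp, fun _ _ _ => by simp,
    fun _ => by simp, fun _ => by simpa using hΛ⟩

variable (d N) in
/-- **THE TRACK'S TIER-2 TARGET TYPE — mass gap uniformly on the weighted ball**: every member of the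
tier-2 ball of loads `(a, Λ)` at weight `t` has the mass gap `PerturbedMassGapAtS d N β W`. Nothing is
asserted by the definition. -/
def MassGapOnBallZdS (β a Λ t : ℝ) : Prop :=
  ∀ W : Potential (ZdEdge d) (Matrix.specialUnitaryGroup (Fin N) ℂ), MemBallZdS a Λ t W →
    PerturbedMassGapAtS d N β W

end Ball

/-! ### The tier-1 ball sits inside the tier-2 ball -/

section Inclusion

variable {ε₀ ε₁ R : ℝ} {W : Potential (ZdEdge d) (Matrix.specialUnitaryGroup (Fin N) ℂ)}
  {supp : Finset (ZdEdge d) → Finset (Finset (ZdEdge d))}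

/-- A tier-1 member has a summable link majorant: through every link only the finitely many listed sets
carry nonzero (continuous, hence bounded) terms. -/
theorem MemBallZd.isLinkSummable (hW : MemBallZd ε₀ ε₁ R W supp) : ∃ B, IsLinkSummable W B := by
  classical
  choose C hC using fun X => exists_bound_of_continuous (hW.continuous X)
  refine ⟨fun X => if W X = 0 then 0 else C X, fun X U => ?_, fun e => ?_⟩
  · split_ifs with h0
    · simp [h0]
    · exact hC X U
  · refine summable_of_ne_finset_zero (s := supp {e}) fun X hX => ?_
    split_ifs with heX h0
    · rfl
    · exact absurd (hW.supportedBy {e} X ⟨e, Finset.mem_inter.2 ⟨heX, Finset.mem_singleton_self e⟩⟩ h0) hX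
    · rfl

/-- **The inclusion of the balls**: a tier-1 member of radii `(ε₀, ε₁)` and range `R` is a tier-2 member of
loads `(ε₀, e^{tR} ε₁)` at every weight `t ≥ 0` — the listed sets through `e` stay within `ℓ^∞`-distance
`R`, so the weight costs at most `e^{tR}` on the cross load, and the diagonal is free. -/
theorem MemBallZd.memBallZdS (hW : MemBallZd ε₀ ε₁ R W supp) {t : ℝ} (ht : 0 ≤ t) :
    MemBallZdS ε₀ (exp (t * R) * ε₁) t W := by
  classical
  obtain ⟨osc, lip, hosc, hlip, hosce, hlipe⟩ := hW.loads
  have hsupp := hW.supportedBy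
  -- a listed-set test: a set through `e` with a nonzero term is listed at `e`
  have hlist : ∀ (e : ZdEdge d) (X : Finset (ZdEdge d)), e ∈ X → W X ≠ 0 → X ∈ supp {e} := fun e X heX h0 =>
    hsupp {e} X ⟨e, Finset.mem_inter.2 ⟨heX, Finset.mem_singleton_self e⟩⟩ h0
  refine ⟨hW.continuous, hW.dependsOn, hW.isLinkSummable,
    fun X y => if W X = 0 then 0 else osc X y, fun X y => if W X = 0 then 0 else lip X y,
    fun e y => ∑ X ∈ (supp {e}).filter (fun X => e ∈ X), (if y ∈ X then lip X y else 0),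
    fun X => ?_, fun X => ?_, fun e => ?_, fun e => ?_, fun e y => ?_, fun e y hye => ?_, fun e => ?_, fun e => ?_⟩
  · -- oscillation witnesses
    by_cases h0 : W X = 0
    · exact ⟨fun _ => by simp [h0], fun y σ τ _ => by simp [h0]⟩
    · exact ⟨fun y => by simp only [if_neg h0]; exact (hosc X).nonneg y,
        fun y σ τ hστ => by simp only [if_neg h0]; exact (hosc X).le y σ τ hστ⟩
  · -- Lipschitz witnesses
    by_cases h0 : W X = 0
    · exact ⟨fun _ => by simp [h0], fun y σ τ _ => by simp [h0]⟩
    · exact ⟨fun y => by simp only [if_neg h0]; exact (hlip X).nonneg y,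
        fun y σ τ hστ => by simp only [if_neg h0]; exact (hlip X).le y σ τ hστ⟩
  · -- summable oscillation load
    refine summable_of_ne_finset_zero (s := supp {e}) fun X hX => ?_
    by_cases heX : e ∈ X
    · by_cases h0 : W X = 0
      · simp [h0]
      · exact absurd (hlist e X heX h0) hX
    · simp [heX]
  · -- oscillation load `≤ ε₀`
    have hzero : ∀ X ∉ supp {e}, (if e ∈ X then (if W X = 0 then 0 else osc X e) else 0) = 0 := by
      intro X hX
      by_cases heX : e ∈ X
      · by_cases h0 : W X = 0
        · simp [h0]
        · exact absurd (hlist e X heX h0) hX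
      · simp [heX]
    rw [tsum_eq_sum (s := supp {e}) hzero]
    refine le_trans ?_ (hosce e)
    rw [Finset.sum_filter]
    refine Finset.sum_le_sum fun X _ => ?_
    split_ifs <;> first | exact le_rfl | exact (hosc X).nonneg e
  · -- summable Lipschitz moduli through `e, y`
    refine summable_of_ne_finset_zero (s := supp {e}) fun X hX => ?_
    by_cases heX : e ∈ X
    · by_cases h0 : W X = 0
      · simp [h0]
      · exact absurd (hlist e X heX h0) hX
    · simp [heX]
  · -- the cross coefficient dominates
    have hzero : ∀ X ∉ supp {e}, (if e ∈ X ∧ y ∈ X then (if W X = 0 then 0 else lip X y) else 0) = 0 := by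
      intro X hX
      by_cases heX : e ∈ X
      · by_cases h0 : W X = 0
        · simp [h0]
        · exact absurd (hlist e X heX h0) hX
      · simp [heX]
    beta_reduce
    rw [tsum_eq_sum (s := supp {e}) hzero, Finset.sum_filter]
    refine Finset.sum_le_sum fun X _ => ?_
    by_cases heX : e ∈ X
    · by_cases hyX : y ∈ X
      · simp only [heX, hyX, and_self, if_true]
        split_ifs
        · exact (hlip X).nonneg y
        · exact le_rfl
      · simp [hyX]
    · simp [heX]
  · -- summable weighted cross load (finitely supported)
    beta_reduce
    refine summable_of_ne_finset_zero (s := ((supp {e}).filter (fun X => e ∈ X)).biUnion id) fun y hy => ?_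
    have hℓ0 : ∑ X ∈ (supp {e}).filter (fun X => e ∈ X), (if y ∈ X then lip X y else 0) = 0 :=
      Finset.sum_eq_zero fun X hX => if_neg fun hyX => hy (Finset.mem_biUnion.2 ⟨X, hX, hyX⟩)
    simp [hℓ0]
  · -- weighted cross load `≤ e^{tR} ε₁`
    beta_reduce
    set T := ((supp {e}).filter (fun X => e ∈ X)).biUnion id with hT
    have hℓ0 : ∀ y ∉ T, ∑ X ∈ (supp {e}).filter (fun X => e ∈ X), (if y ∈ X then lip X y else 0) = 0 :=
      fun y hy => Finset.sum_eq_zero fun X hX => if_neg fun hyX => hy (Finset.mem_biUnion.2 ⟨X, hX, hyX⟩)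
    have hzero : ∀ y ∉ T, (if y = e then 0 else
        ∑ X ∈ (supp {e}).filter (fun X => e ∈ X), (if y ∈ X then lip X y else 0)) * exp (t * ‖e.1 - y.1‖) = 0 :=
      fun y hy => by simp [hℓ0 y hy]
    rw [tsum_eq_sum (s := T) hzero]
    have hnn : ∀ y, 0 ≤ ∑ X ∈ (supp {e}).filter (fun X => e ∈ X), (if y ∈ X then lip X y else 0) :=
      fun y => Finset.sum_nonneg fun X _ => by
        split_ifs
        · exact (hlip X).nonneg y
        · exact le_rfl
    have hif0 : ∀ y, 0 ≤ (if y = e then 0 else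
        ∑ X ∈ (supp {e}).filter (fun X => e ∈ X), (if y ∈ X then lip X y else 0)) := fun y => by
      split_ifs
      · exact le_rfl
      · exact hnn y
    have hw : ∀ y ∈ T, exp (t * ‖e.1 - y.1‖) ≤ exp (t * R) := by
      intro y hy
      obtain ⟨X, hX, hyX⟩ := Finset.mem_biUnion.1 hy
      obtain ⟨hXs, heX⟩ := Finset.mem_filter.1 hX
      exact exp_le_exp.2 (mul_le_mul_of_nonneg_left (hW.range e X hXs heX y hyX) ht)
    have hpt : ∀ y ∈ T, (if y = e then 0 else
        ∑ X ∈ (supp {e}).filter (fun X => e ∈ X), (if y ∈ X then lip X y else 0)) ≤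
        (if y ∈ perturbedNbr supp e then
          ∑ X ∈ (supp {e}).filter (fun X => e ∈ X), (if y ∈ X then lip X y else 0) else 0) := by
      intro y hy
      by_cases hye : y = e
      · rw [if_pos hye]
        split_ifs
        · exact hnn y
        · exact le_rfl
      · obtain ⟨X, hX, hyX⟩ := Finset.mem_biUnion.1 hy
        obtain ⟨hXs, heX⟩ := Finset.mem_filter.1 hX
        rw [if_neg hye, if_pos (mem_perturbedNbr_of_mem_supp hXs heX hyX hye)]
    calc ∑ y ∈ T, (if y = e then 0 else
          ∑ X ∈ (supp {e}).filter (fun X => e ∈ X), (if y ∈ X then lip X y else 0)) * exp (t * ‖e.1 - y.1‖)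
        ≤ ∑ y ∈ T, (if y = e then 0 else
          ∑ X ∈ (supp {e}).filter (fun X => e ∈ X), (if y ∈ X then lip X y else 0)) * exp (t * R) :=
          Finset.sum_le_sum fun y hy => mul_le_mul_of_nonneg_left (hw y hy) (hif0 y)
      _ = exp (t * R) * ∑ y ∈ T, (if y = e then 0 else
          ∑ X ∈ (supp {e}).filter (fun X => e ∈ X), (if y ∈ X then lip X y else 0)) := by
          rw [← Finset.sum_mul, mul_comm]
      _ ≤ exp (t * R) * ∑ y ∈ T, (if y ∈ perturbedNbr supp e then
          ∑ X ∈ (supp {e}).filter (fun X => e ∈ X), (if y ∈ X then lip X y else 0) else 0) :=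
          mul_le_mul_of_nonneg_left (Finset.sum_le_sum hpt) (exp_pos _).le
      _ = exp (t * R) * ∑ y ∈ T.filter (fun y => y ∈ perturbedNbr supp e),
          ∑ X ∈ (supp {e}).filter (fun X => e ∈ X), (if y ∈ X then lip X y else 0) := by
          rw [Finset.sum_filter]
      _ ≤ exp (t * R) * ∑ y ∈ perturbedNbr supp e,
          ∑ X ∈ (supp {e}).filter (fun X => e ∈ X), (if y ∈ X then lip X y else 0) :=
          mul_le_mul_of_nonneg_left (Finset.sum_le_sum_of_subset_of_nonneg
            (fun y hy => (Finset.mem_filter.1 hy).2) (fun y _ _ => hnn y)) (exp_pos _).le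
      _ ≤ exp (t * R) * ∑ y ∈ perturbedNbr supp e, ∑ X ∈ (supp {e}).filter (fun X => e ∈ X), lip X y :=
          mul_le_mul_of_nonneg_left (Finset.sum_le_sum fun y _ => Finset.sum_le_sum fun X _ => by
            split_ifs
            · exact le_rfl
            · exact (hlip X).nonneg y) (exp_pos _).le
      _ ≤ exp (t * R) * ε₁ := mul_le_mul_of_nonneg_left (hlipe e) (exp_pos _).le

/-- **The tier-2 theorem contains the tier-1 theorem**: mass gap on the weighted ball of loads `(a, Λ)`
at weight `t ≥ 0` gives mass gap on every tier-1 ball of radii `(ε₀, ε₁)` and range `R` with `ε₀ ≤ a`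
and `e^{tR} ε₁ ≤ Λ` (inclusion of the balls, and `perturbedMassGapAtS_iff_of_supportedBy`). -/
theorem MassGapOnBallZdS.massGapOnBallZd {β a Λ t ε₀ ε₁ R : ℝ} (h : MassGapOnBallZdS d N β a Λ t)
    (ht : 0 ≤ t) (h₀ : ε₀ ≤ a) (h₁ : exp (t * R) * ε₁ ≤ Λ) : MassGapOnBallZd d N β ε₀ ε₁ R :=
  fun W _ hW => (perturbedMassGapAtS_iff_of_supportedBy β hW.supportedBy).1
    (h W ((hW.memBallZdS ht).mono h₀ h₁))

end Inclusion

end Summit.Ventures.YMGap.RobustBall
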